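import Mathlib.Analysis.Normed.Group.InfiniteSum
import Mathlib.Analysis.SpecificLimits.Normed
import Literature.Barriers.CriticalPhenomena.WeaklySAWCouplingFlow
import HarnessLib

/-!
# The quadratic flow `φ̄` of Bauerschmidt–Brydges–Slade (§6.1) in the massless setting:
# the global flow `(ḡ, z̄, μ̄)` with final conditions `(z̄_∞, μ̄_∞) = (0, 0)`

Continuation of `WeaklySAWCouplingFlow.lean`. The perturbative ("quadratic") flow of the
coupling constants of BBS 2015, §6.1, in the transformed variables, is the triangular system

  `ḡ_{j+1} = ḡ_j - β_jḡ_j²`, `z̄_{j+1} = z̄_j - θ_jḡ_j²`,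
  `μ̄_{j+1} = L²μ̄_j(1 - γβ_jḡ_j) + η_jḡ_j - ξ_jḡ_j² - π_jḡ_jz̄_j`,

and the proposition of §6.1 (a special case of [BBS-rg-flow, Proposition 1.2]) asserts: for
`ḡ₀ > 0` small there is a UNIQUE global flow with initial condition `ḡ₀` and final condition
`(z̄_∞, μ̄_∞) = (0, 0)`, with `χ_jḡ_j^p = O((ḡ₀/(1 + ḡ₀j))^p)`, `z̄_j, μ̄_j = O(χ_jḡ_j)`. The
critical initial data `(z̄₀, μ̄₀)` so determined are the perturbative shadow of the critical
point `(z₀ᶜ, ν₀ᶜ)` of Theorem 4.1 (§7: Proposition 7.1.1 perturbs this flow by the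
renormalisation-group remainder), and §8.5 (Theorem 1.2, `ν_c = -𝖺g + O(g²)`) is the evaluation
of `μ̌₀` by "infinite iteration" of the `μ̌`-equation.

This file proves that proposition in the MASSLESS setting `m² = 0`, where `j_Ω = ∞` and the
weights `χ_j` are identically `1`, so that Assumptions (A1)–(A2) read: `β_j ≥ c > 0` for all `j`
(in the source `β_j > 0` and `β_j → log L/π²`), `|θ_j|, |η_j|, |ξ_j|, |π_j| ≤ A`; the expansion
factor is `λ = L² ≥ 2`; `γ ∈ [0, 1]` (`γ = 1/4` in the source); `GbarHyp` supplies `0 ≤ β_j ≤ B`,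
`g₀ > 0`, `Bg₀ ≤ 1/4`. (The general, massive statement differs only through the weights
`χ_j = Ω^{-(j-j_Ω)₊}` in the hypotheses on `θ, η, ξ, π` and in the conclusions; it needs
[BBS-rg-flow, Lemma 2.1(ii)] in full and is not treated here.) With explicit constants:
* `ḡ_j ≤ g₀/(1 + g₀cj)` (`gbar_le_linear`), `Σ_{l≥j} ḡ_l² ≤ ḡ_j/c` (`tsum_gbar_sq_shift_le`,
  [BBS-rg-flow, Lemma 2.1(ii)(a)] with `n = 2`);
* `z̄_j := Σ_{l≥j} θ_lḡ_l²` solves the `z̄`-equation, `|z̄_j| ≤ (A/c)ḡ_j`, `z̄_j → 0`, and is the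
  unique solution tending to `0` (`zbar_succ`, `abs_zbar_le`, `tendsto_zbar_zero`, `zbar_unique`);
* `μ̄_j := -Σ_{l≥j} (∏_{k=j}^{l} Λ_k⁻¹) σ_l`, `Λ_k = L²(1 - γβ_kḡ_k) ≥ 3/2`,
  `σ_l = η_lḡ_l - ξ_lḡ_l² - π_lḡ_lz̄_l`, solves the `μ̄`-equation, `|μ̄_j| ≤ 2Kḡ_j` with
  `K = A(1 + g₀ + (A/c)g₀)`, `μ̄_j → 0`, and is the unique BOUNDED solution (the `μ`-direction is
  expanding) (`mubar_succ`, `abs_mubar_le`, `tendsto_mubar_zero`, `mubar_unique`);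
* the packaged statement `quadraticFlow_global`.
This follows [BBS-rg-flow, Lemma 2.2] (existence, uniqueness, bounds) line by line.

## References
* R. Bauerschmidt, D. C. Brydges, G. Slade, CMP 337 (2015), §6.1 (the quadratic flow and the
  proposition on its global flow), §8.5. [BauerschmidtBrydgesSlade2015LogCorr]
* R. Bauerschmidt, D. C. Brydges, G. Slade, Ann. Henri Poincaré 16 (2015), Proposition 1.2,
  Lemma 2.1(ii), Lemma 2.2. [BauerschmidtBrydgesSlade2015Flow]
-/

noncomputable section

open Filter Topology Finset
open scoped BigOperators

namespace Literature.Barriers.CriticalPhenomena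

namespace CTWSAW

/-! ### The objects: `z̄`, `Λ_j = L²(1 - γβ_jḡ_j)`, `σ_j`, `μ̄` -/

/-- `z̄_j = Σ_{l ≥ j} θ_lḡ_l²`, the solution of `z̄_{j+1} = z̄_j - θ_jḡ_j²` with `z̄_∞ = 0`.
[cite: BauerschmidtBrydgesSlade2015Flow, Lemma 2.2 (proof, the display for z̄_j with ζ = 0)]
[cite: BauerschmidtBrydgesSlade2015LogCorr, §6.1 (the z̄-equation of φ̄)] -/
def zbar (β θ : ℕ → ℝ) (g₀ : ℝ) (j : ℕ) : ℝ :=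
  ∑' l, θ (l + j) * gbar β g₀ (l + j) ^ 2

/-- The multiplier `Λ_j = λ(1 - γβ_jḡ_j)` of `μ̄_j` in the `μ̄`-equation
`μ̄_{j+1} = L²μ̄_j(1 - γβ_jḡ_j) + η_jḡ_j - ξ_jḡ_j² - π_jḡ_jz̄_j` (`λ = L²`; "`λ_j - τ_j`" of the flow paper).
[cite: BauerschmidtBrydgesSlade2015LogCorr, §6.1 (the μ̄-equation of φ̄)]
[cite: BauerschmidtBrydgesSlade2015Flow, Lemma 2.2 (proof: μ̄_{j+1} = (λ_j - τ_j)μ̄_j + σ_j)] -/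
def lamFac (β : ℕ → ℝ) (g₀ lam γ : ℝ) (j : ℕ) : ℝ :=
  lam * (1 - γ * (β j * gbar β g₀ j))

/-- The inhomogeneity `σ_j = η_jḡ_j - ξ_jḡ_j² - π_jḡ_jz̄_j` of the `μ̄`-equation.
[cite: BauerschmidtBrydgesSlade2015Flow, Lemma 2.2 (proof, definition of σ_j)]
[cite: BauerschmidtBrydgesSlade2015LogCorr, §6.1 (the μ̄-equation of φ̄)] -/
def sigmaTerm (β θ η ξ π : ℕ → ℝ) (g₀ : ℝ) (j : ℕ) : ℝ :=
  η j * gbar β g₀ j - ξ j * gbar β g₀ j ^ 2 - π j * gbar β g₀ j * zbar β θ g₀ j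

/-- `∏_{k=j}^{j+l} Λ_k⁻¹`. [cite: BauerschmidtBrydgesSlade2015Flow, Lemma 2.2 (proof, the display for μ̄_j)] -/
def invProd (β : ℕ → ℝ) (g₀ lam γ : ℝ) (j l : ℕ) : ℝ :=
  ∏ k ∈ range (l + 1), (lamFac β g₀ lam γ (k + j))⁻¹

/-- `μ̄_j = -Σ_{l ≥ j} (∏_{k=j}^{l} Λ_k⁻¹) σ_l`, the bounded solution of `μ̄_{j+1} = Λ_jμ̄_j + σ_j`
("the unique solution which obeys the boundary condition `μ̄_∞ = 0`").
[cite: BauerschmidtBrydgesSlade2015Flow, Lemma 2.2 (proof, the display for μ̄_j)]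
[cite: BauerschmidtBrydgesSlade2015LogCorr, §6.1 (Proposition on the global flow of φ̄)] -/
def mubar (β θ η ξ π : ℕ → ℝ) (g₀ lam γ : ℝ) (j : ℕ) : ℝ :=
  -∑' l, invProd β g₀ lam γ j l * sigmaTerm β θ η ξ π g₀ (l + j)

/-- Hypotheses of the quadratic flow in the MASSLESS setting (`j_Ω = ∞`, `χ_j = 1`): `GbarHyp` and,
as Assumptions (A1)–(A2) then read, `β_j ≥ c > 0` for all `j`, `|θ_j|, |η_j|, |ξ_j|, |π_j| ≤ A`;
`λ = L² ≥ 2`; `0 ≤ γ ≤ 1` (`γ = 1/4` in the source).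
[cite: BauerschmidtBrydgesSlade2015LogCorr, §6.1 (Assumptions (A1)–(A2))]
[cite: BauerschmidtBrydgesSlade2015Flow, Assumptions (A1)–(A2) (case j_Ω = ∞)] -/
structure QuadFlowHyp (β θ η ξ π : ℕ → ℝ) (B c A g₀ lam γ : ℝ) : Prop
    extends GbarHyp β B g₀ where
  /-- `c > 0`. -/
  c_pos : 0 < c
  /-- (A1), massless: `β_j ≥ c` for all `j`. -/
  beta_ge : ∀ j, c ≤ β j
  /-- (A2): `|θ_j| ≤ A`. -/
  theta_le : ∀ j, |θ j| ≤ A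
  /-- (A2): `|η_j| ≤ A`. -/
  eta_le : ∀ j, |η j| ≤ A
  /-- (A2): `|ξ_j| ≤ A`. -/
  xi_le : ∀ j, |ξ j| ≤ A
  /-- (A2): `|π_j| ≤ A`. -/
  pi_le : ∀ j, |π j| ≤ A
  /-- `λ = L² ≥ 2`. -/
  two_le_lam : 2 ≤ lam
  /-- `γ ≥ 0`. -/
  gamma_nonneg : 0 ≤ γ
  /-- `γ ≤ 1`. -/
  gamma_le_one : γ ≤ 1

namespace QuadFlowHyp

variable {β θ η ξ π : ℕ → ℝ} {B c A g₀ lam γ : ℝ} (h : QuadFlowHyp β θ η ξ π B c A g₀ lam γ)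
include h

/-- `A ≥ 0`. [folklore] -/
theorem A_nonneg : 0 ≤ A := (abs_nonneg _).trans (h.theta_le 0)

/-! ### `ḡ` in the massless setting: `ḡ_j = O(g₀/(1 + g₀j))`, `Σ_{l≥j} ḡ_l² ≤ ḡ_j/c` -/

/-- **`ḡ_j ≤ g₀/(1 + g₀cj)`** ("`χ_jḡ_j = O(ḡ₀/(1 + ḡ₀j))`").
[cite: BauerschmidtBrydgesSlade2015LogCorr, §6.1 (Proposition on the global flow of φ̄, first estimate, p = 1)]
[cite: BauerschmidtBrydgesSlade2015Flow, Proposition 1.2 and Lemma 2.1(ii)(b)] -/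
theorem gbar_le_linear (j : ℕ) : gbar β g₀ j ≤ g₀ / (1 + g₀ * c * j) := by
  refine (h.toGbarHyp.gbar_le_of_sum j).trans ?_
  have hS : c * j ≤ ∑ i ∈ range j, β i := by
    calc c * j = ∑ _i ∈ range j, c := by rw [sum_const, card_range]; ring
      _ ≤ ∑ i ∈ range j, β i := sum_le_sum fun i _ => h.beta_ge i
  have h1 : 0 < 1 + g₀ * c * j := by
    have : 0 ≤ g₀ * c * j := by have := h.pos; have := h.c_pos; positivity
    linarith
  exact div_le_div_of_nonneg_left h.pos.le h1 (by nlinarith [h.pos])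

/-- `ḡ_j → 0` in the massless setting. [cite: BauerschmidtBrydgesSlade2015Flow, Example 1.1(i)] -/
theorem tendsto_gbar_zero : Tendsto (gbar β g₀) atTop (𝓝 0) := by
  have hup : Tendsto (fun j : ℕ => g₀ / (1 + g₀ * c * j)) atTop (𝓝 0) := by
    have h1 : Tendsto (fun j : ℕ => 1 + g₀ * c * (j : ℝ)) atTop atTop :=
      tendsto_atTop_add_const_left _ _
        (Tendsto.const_mul_atTop (mul_pos h.pos h.c_pos) tendsto_natCast_atTop_atTop)
    exact tendsto_const_nhds.div_atTop h1
  exact tendsto_of_tendsto_of_tendsto_of_le_of_le' tendsto_const_nhds hup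
    (Eventually.of_forall fun j => (h.gbar_pos j).le) (Eventually.of_forall h.gbar_le_linear)

/-- `cḡ_l² ≤ ḡ_l - ḡ_{l+1}` (`= β_lḡ_l²`). [cite: BauerschmidtBrydgesSlade2015Flow, Lemma 2.1 (proof of (ii-a): β_lḡ_l² = ḡ_l - ḡ_{l+1})] -/
theorem c_mul_gbar_sq_le (l : ℕ) : c * gbar β g₀ l ^ 2 ≤ gbar β g₀ l - gbar β g₀ (l + 1) := by
  rw [gbar_succ]
  nlinarith [h.beta_ge l, sq_nonneg (gbar β g₀ l)]

/-- Shifted partial sums: `Σ_{l<n} ḡ_{l+j}² ≤ (ḡ_j - ḡ_{j+n})/c ≤ ḡ_j/c`.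
[cite: BauerschmidtBrydgesSlade2015Flow, Lemma 2.1(ii)(a) (n = 2, m = 0, χ = 1)] -/
theorem sum_gbar_sq_shift_le (j n : ℕ) :
    ∑ l ∈ range n, gbar β g₀ (l + j) ^ 2 ≤ gbar β g₀ j / c := by
  rw [le_div_iff₀ h.c_pos, sum_mul]
  calc ∑ l ∈ range n, gbar β g₀ (l + j) ^ 2 * c
      ≤ ∑ l ∈ range n, (gbar β g₀ (l + j) - gbar β g₀ (l + 1 + j)) :=
        sum_le_sum fun l _ => by
          have := h.c_mul_gbar_sq_le (l + j)
          rw [Nat.add_right_comm]; linarith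
    _ = gbar β g₀ j - gbar β g₀ (n + j) := by
        rw [sum_range_sub' (fun l => gbar β g₀ (l + j))]; simp
    _ ≤ gbar β g₀ j := by linarith [h.gbar_pos (n + j)]

/-- `Σ_l ḡ_{l+j}²` converges. [cite: BauerschmidtBrydgesSlade2015Flow, Lemma 2.1(ii)(a)] -/
theorem summable_gbar_sq_shift (j : ℕ) : Summable fun l => gbar β g₀ (l + j) ^ 2 :=
  summable_of_sum_range_le (fun _ => sq_nonneg _) (h.sum_gbar_sq_shift_le j)

/-- **`Σ_{l≥j} ḡ_l² ≤ ḡ_j/c`** (Lemma 2.1(ii)(a) of the flow paper with `n = 2`, massless).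
[cite: BauerschmidtBrydgesSlade2015Flow, Lemma 2.1(ii)(a) (n = 2, m = 0, χ = 1)] -/
theorem tsum_gbar_sq_shift_le (j : ℕ) : ∑' l, gbar β g₀ (l + j) ^ 2 ≤ gbar β g₀ j / c :=
  (h.summable_gbar_sq_shift j).tsum_le_of_sum_range_le (h.sum_gbar_sq_shift_le j)

/-! ### `z̄`: the recursion, the bound `|z̄_j| ≤ (A/c)ḡ_j`, `z̄_j → 0`, uniqueness -/

/-- The series defining `z̄_j` converges absolutely. [cite: BauerschmidtBrydgesSlade2015Flow, Lemma 2.2 (proof)] -/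
theorem summable_zbar_term (j : ℕ) : Summable fun l => θ (l + j) * gbar β g₀ (l + j) ^ 2 := by
  refine Summable.of_norm_bounded ((h.summable_gbar_sq_shift j).mul_left A) fun l => ?_
  rw [Real.norm_eq_abs, abs_mul, abs_of_nonneg (sq_nonneg (gbar β g₀ (l + j)))]
  exact mul_le_mul_of_nonneg_right (h.theta_le _) (sq_nonneg _)

/-- **The `z̄`-equation**: `z̄_{j+1} = z̄_j - θ_jḡ_j²`. [cite: BauerschmidtBrydgesSlade2015LogCorr, §6.1 (the z̄-equation of φ̄)]
[cite: BauerschmidtBrydgesSlade2015Flow, Lemma 2.2] -/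
theorem zbar_succ (j : ℕ) : zbar β θ g₀ (j + 1) = zbar β θ g₀ j - θ j * gbar β g₀ j ^ 2 := by
  have hs := h.summable_zbar_term j
  rw [zbar, zbar, hs.tsum_eq_zero_add]
  simp only [zero_add, add_sub_cancel_left]
  exact tsum_congr fun l => by rw [Nat.add_right_comm, Nat.add_assoc]

/-- **`|z̄_j| ≤ (A/c)ḡ_j`** ("`z̄_j = O(χ_jḡ_j)`"). [cite: BauerschmidtBrydgesSlade2015Flow, Lemma 2.2 (z̄_j = O(χ_jḡ_j))]
[cite: BauerschmidtBrydgesSlade2015LogCorr, §6.1 (Proposition on the global flow of φ̄: z̄_j = O(χ_jḡ_j))] -/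
theorem abs_zbar_le (j : ℕ) : |zbar β θ g₀ j| ≤ A / c * gbar β g₀ j := by
  have hs := h.summable_zbar_term j
  calc |zbar β θ g₀ j| ≤ ∑' l, |θ (l + j) * gbar β g₀ (l + j) ^ 2| := by
        have := norm_tsum_le_tsum_norm (f := fun l => θ (l + j) * gbar β g₀ (l + j) ^ 2)
          (by simpa only [Real.norm_eq_abs] using hs.abs)
        simpa only [zbar, Real.norm_eq_abs] using this
    _ ≤ ∑' l, A * gbar β g₀ (l + j) ^ 2 := by
        refine Summable.tsum_le_tsum (fun l => ?_) hs.abs ((h.summable_gbar_sq_shift j).mul_left A)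
        rw [abs_mul, abs_of_nonneg (sq_nonneg (gbar β g₀ (l + j)))]
        exact mul_le_mul_of_nonneg_right (h.theta_le _) (sq_nonneg _)
    _ = A * ∑' l, gbar β g₀ (l + j) ^ 2 := tsum_mul_left
    _ ≤ A * (gbar β g₀ j / c) := mul_le_mul_of_nonneg_left (h.tsum_gbar_sq_shift_le j) h.A_nonneg
    _ = A / c * gbar β g₀ j := by ring

/-- `|z̄_j| ≤ (A/c)g₀`. [folklore] -/
theorem abs_zbar_le' (j : ℕ) : |zbar β θ g₀ j| ≤ A / c * g₀ :=
  (h.abs_zbar_le j).trans (mul_le_mul_of_nonneg_left (h.gbar_le_init j)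
    (div_nonneg h.A_nonneg h.c_pos.le))

omit h in
/-- **`z̄_j → 0`** (the final condition). [cite: BauerschmidtBrydgesSlade2015Flow, Lemma 2.2 (z̄_∞ = 0)] -/
theorem tendsto_zbar_zero : Tendsto (zbar β θ g₀) atTop (𝓝 0) :=
  tendsto_sum_nat_add fun l => θ l * gbar β g₀ l ^ 2

/-- **Uniqueness for `z̄`**: a solution of `z_{j+1} = z_j - θ_jḡ_j²` tending to `0` is `z̄`.
[cite: BauerschmidtBrydgesSlade2015Flow, Lemma 2.2 (uniqueness of the solution with z̄_∞ = 0)] -/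
theorem zbar_unique {z : ℕ → ℝ} (hz : ∀ j, z (j + 1) = z j - θ j * gbar β g₀ j ^ 2)
    (hz0 : Tendsto z atTop (𝓝 0)) : z = zbar β θ g₀ := by
  have hconst : ∀ j, z j - zbar β θ g₀ j = z 0 - zbar β θ g₀ 0 := by
    intro j
    induction j with
    | zero => rfl
    | succ j ih => rw [hz, h.zbar_succ, ← ih]; ring
  have hlim : Tendsto (fun j => z j - zbar β θ g₀ j) atTop (𝓝 (z 0 - zbar β θ g₀ 0)) := by
    simp_rw [hconst]; exact tendsto_const_nhds
  have h0 : z 0 - zbar β θ g₀ 0 = 0 :=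
    tendsto_nhds_unique hlim (by simpa using hz0.sub tendsto_zbar_zero)
  funext j
  have := hconst j
  rw [h0] at this
  linarith

/-! ### `μ̄`: the multipliers, the recursion, the bound `|μ̄_j| ≤ 2Kḡ_j`, `μ̄_j → 0`, uniqueness -/

/-- `Λ_j ≥ (3/4)λ ≥ 3/2`. [cite: BauerschmidtBrydgesSlade2015Flow, Lemma 2.2 (proof: (λ_j - τ_j)⁻¹ ≤ α < 1)] -/
theorem lamFac_ge (j : ℕ) : 3 / 2 ≤ lamFac β g₀ lam γ j := by
  unfold lamFac
  have h1 : γ * (β j * gbar β g₀ j) ≤ 1 / 4 := by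
    nlinarith [h.beta_mul_gbar_le j, h.beta_mul_gbar_nonneg j, h.gamma_le_one, h.gamma_nonneg]
  nlinarith [h.two_le_lam]

/-- `0 < Λ_j⁻¹ ≤ 2/3`. [cite: BauerschmidtBrydgesSlade2015Flow, Lemma 2.2 (proof: ½λ⁻¹ ≤ (λ_j - τ_j)⁻¹ ≤ α)] -/
theorem inv_lamFac_mem (j : ℕ) : (lamFac β g₀ lam γ j)⁻¹ ∈ Set.Ioc (0 : ℝ) (2 / 3) := by
  have := h.lamFac_ge j
  exact ⟨inv_pos.2 (by linarith), by rw [inv_le_comm₀ (by linarith) (by norm_num)]; linarith⟩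

/-- `0 ≤ ∏_{k=j}^{j+l} Λ_k⁻¹ ≤ (2/3)^{l+1}`. [cite: BauerschmidtBrydgesSlade2015Flow, Lemma 2.2 (proof: |μ̄_j| ≤ Σ α^{l-j+1}O(χ_lḡ_l))] -/
theorem invProd_mem (j l : ℕ) : invProd β g₀ lam γ j l ∈ Set.Icc (0 : ℝ) ((2 / 3) ^ (l + 1)) := by
  unfold invProd
  refine ⟨prod_nonneg fun k _ => (h.inv_lamFac_mem _).1.le, ?_⟩
  calc ∏ k ∈ range (l + 1), (lamFac β g₀ lam γ (k + j))⁻¹ ≤ ∏ _k ∈ range (l + 1), (2 / 3 : ℝ) :=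
        prod_le_prod (fun k _ => (h.inv_lamFac_mem _).1.le) fun k _ => (h.inv_lamFac_mem _).2
    _ = (2 / 3) ^ (l + 1) := by rw [prod_const, card_range]

omit h in
/-- `∏_{k=j}^{j+l+1} Λ_k⁻¹ = Λ_j⁻¹ ∏_{k=j+1}^{j+1+l} Λ_k⁻¹`. [folklore] -/
theorem invProd_succ (j l : ℕ) :
    invProd β g₀ lam γ j (l + 1) = (lamFac β g₀ lam γ j)⁻¹ * invProd β g₀ lam γ (j + 1) l := by
  unfold invProd
  rw [prod_range_succ' _ (l + 1), zero_add, mul_comm]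
  congr 1
  exact prod_congr rfl fun k _ => by rw [Nat.add_right_comm, Nat.add_assoc]

omit h in
/-- `invProd j 0 = Λ_j⁻¹`. [folklore] -/
theorem invProd_zero (j : ℕ) : invProd β g₀ lam γ j 0 = (lamFac β g₀ lam γ j)⁻¹ := by
  simp [invProd]

/-- The constant `K = A(1 + g₀ + (A/c)g₀)` with `|σ_j| ≤ Kḡ_j`. [folklore] -/
theorem abs_sigmaTerm_le (j : ℕ) :
    |sigmaTerm β θ η ξ π g₀ j| ≤ A * (1 + g₀ + A / c * g₀) * gbar β g₀ j := by
  unfold sigmaTerm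
  have hg := (h.gbar_pos j).le
  have hg1 := h.gbar_le_init j
  have h1 : |η j * gbar β g₀ j| ≤ A * gbar β g₀ j := by
    rw [abs_mul, abs_of_nonneg hg]; exact mul_le_mul_of_nonneg_right (h.eta_le j) hg
  have h2 : |ξ j * gbar β g₀ j ^ 2| ≤ A * g₀ * gbar β g₀ j := by
    rw [abs_mul, abs_of_nonneg (sq_nonneg (gbar β g₀ j)), sq, ← mul_assoc]
    exact mul_le_mul_of_nonneg_right (by
      calc |ξ j| * gbar β g₀ j ≤ A * g₀ := mul_le_mul (h.xi_le j) hg1 hg h.A_nonneg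
        ) hg
  have h3 : |π j * gbar β g₀ j * zbar β θ g₀ j| ≤ A * (A / c * g₀) * gbar β g₀ j := by
    rw [abs_mul, abs_mul, abs_of_nonneg hg]
    calc |π j| * gbar β g₀ j * |zbar β θ g₀ j| = |π j| * |zbar β θ g₀ j| * gbar β g₀ j := by ring
      _ ≤ A * (A / c * g₀) * gbar β g₀ j :=
        mul_le_mul_of_nonneg_right (mul_le_mul (h.pi_le j) (h.abs_zbar_le' j) (abs_nonneg _)
          h.A_nonneg) hg
  calc |η j * gbar β g₀ j - ξ j * gbar β g₀ j ^ 2 - π j * gbar β g₀ j * zbar β θ g₀ j|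
      ≤ |η j * gbar β g₀ j| + |ξ j * gbar β g₀ j ^ 2| + |π j * gbar β g₀ j * zbar β θ g₀ j| :=
        (abs_sub _ _).trans (add_le_add (abs_sub _ _) le_rfl)
    _ ≤ A * gbar β g₀ j + A * g₀ * gbar β g₀ j + A * (A / c * g₀) * gbar β g₀ j := by linarith
    _ = A * (1 + g₀ + A / c * g₀) * gbar β g₀ j := by ring

/-- `K ≥ 0`. [folklore] -/
theorem K_nonneg : 0 ≤ A * (1 + g₀ + A / c * g₀) := by
  have := h.A_nonneg; have := h.pos; have := h.c_pos
  positivity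

/-- Termwise bound for the series of `μ̄_j`: `|∏Λ⁻¹ σ_{l+j}| ≤ Kḡ_j (2/3)^{l+1}`.
[cite: BauerschmidtBrydgesSlade2015Flow, Lemma 2.2 (proof: |μ̄_j| ≤ Σ_{l≥j} α^{l-j+1}O(χ_lḡ_l))] -/
theorem abs_mubar_term_le (j l : ℕ) :
    |invProd β g₀ lam γ j l * sigmaTerm β θ η ξ π g₀ (l + j)| ≤
      A * (1 + g₀ + A / c * g₀) * gbar β g₀ j * (2 / 3) ^ (l + 1) := by
  obtain ⟨hP0, hP1⟩ := h.invProd_mem j l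
  rw [abs_mul, abs_of_nonneg hP0]
  calc invProd β g₀ lam γ j l * |sigmaTerm β θ η ξ π g₀ (l + j)|
      ≤ (2 / 3) ^ (l + 1) * (A * (1 + g₀ + A / c * g₀) * gbar β g₀ j) := by
        refine mul_le_mul hP1 ((h.abs_sigmaTerm_le _).trans ?_) (abs_nonneg _) (by positivity)
        exact mul_le_mul_of_nonneg_left (h.gbar_antitone (Nat.le_add_left j l)) h.K_nonneg
    _ = _ := by ring

/-- The series defining `μ̄_j` converges (geometrically). [cite: BauerschmidtBrydgesSlade2015Flow, Lemma 2.2 (proof: geometric convergence of the sum)] -/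
theorem summable_mubar_term (j : ℕ) :
    Summable fun l => invProd β g₀ lam γ j l * sigmaTerm β θ η ξ π g₀ (l + j) := by
  refine Summable.of_norm_bounded
    (((summable_geometric_of_lt_one (by norm_num) (by norm_num : (2 : ℝ) / 3 < 1)).mul_left
      (A * (1 + g₀ + A / c * g₀) * gbar β g₀ j * (2 / 3)))) fun l => ?_
  rw [Real.norm_eq_abs]
  refine (h.abs_mubar_term_le j l).trans_eq ?_
  ring

/-- **The `μ̄`-equation**: `μ̄_{j+1} = λμ̄_j(1 - γβ_jḡ_j) + η_jḡ_j - ξ_jḡ_j² - π_jḡ_jz̄_j`.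
[cite: BauerschmidtBrydgesSlade2015LogCorr, §6.1 (the μ̄-equation of φ̄, λ = L²)]
[cite: BauerschmidtBrydgesSlade2015Flow, Lemma 2.2] -/
theorem mubar_succ (j : ℕ) :
    mubar β θ η ξ π g₀ lam γ (j + 1) =
      lam * mubar β θ η ξ π g₀ lam γ j * (1 - γ * (β j * gbar β g₀ j)) +
        η j * gbar β g₀ j - ξ j * gbar β g₀ j ^ 2 - π j * gbar β g₀ j * zbar β θ g₀ j := by
  have hs := h.summable_mubar_term j
  have hΛ : lamFac β g₀ lam γ j ≠ 0 := by have := h.lamFac_ge j; positivity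
  -- μ̄_j = Λ_j⁻¹ (μ̄_{j+1} - σ_j)
  have key : mubar β θ η ξ π g₀ lam γ j =
      (lamFac β g₀ lam γ j)⁻¹ * (mubar β θ η ξ π g₀ lam γ (j + 1) - sigmaTerm β θ η ξ π g₀ j) := by
    rw [mubar, mubar, hs.tsum_eq_zero_add]
    simp only [zero_add, invProd_zero]
    have h2 : ∑' l, invProd β g₀ lam γ j (l + 1) * sigmaTerm β θ η ξ π g₀ (l + 1 + j) =
        (lamFac β g₀ lam γ j)⁻¹ *
          ∑' l, invProd β g₀ lam γ (j + 1) l * sigmaTerm β θ η ξ π g₀ (l + (j + 1)) := by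
      rw [← tsum_mul_left]
      exact tsum_congr fun l => by rw [invProd_succ, Nat.add_right_comm, Nat.add_assoc]; ring
    rw [h2]
    ring
  set M := mubar β θ η ξ π g₀ lam γ (j + 1) with hM
  rw [key]
  calc M = lamFac β g₀ lam γ j * ((lamFac β g₀ lam γ j)⁻¹ * (M - sigmaTerm β θ η ξ π g₀ j)) +
        sigmaTerm β θ η ξ π g₀ j := by
        rw [← mul_assoc, mul_inv_cancel₀ hΛ, one_mul, sub_add_cancel]
    _ = _ := by unfold lamFac sigmaTerm; ring

/-- **`|μ̄_j| ≤ 2Kḡ_j`**, `K = A(1 + g₀ + (A/c)g₀)` ("`μ̄_j = O(χ_jḡ_j)`").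
[cite: BauerschmidtBrydgesSlade2015Flow, Lemma 2.2 (μ̄_j = O(χ_jḡ_j))]
[cite: BauerschmidtBrydgesSlade2015LogCorr, §6.1 (Proposition on the global flow of φ̄: μ̄_j = O(χ_jḡ_j))] -/
theorem abs_mubar_le (j : ℕ) :
    |mubar β θ η ξ π g₀ lam γ j| ≤ 2 * (A * (1 + g₀ + A / c * g₀)) * gbar β g₀ j := by
  have hs := h.summable_mubar_term j
  set K := A * (1 + g₀ + A / c * g₀) with hK
  have hgeo : HasSum (fun l : ℕ => K * gbar β g₀ j * (2 / 3) ^ (l + 1)) (2 * K * gbar β g₀ j) := by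
    have h1 := (hasSum_geometric_of_lt_one (by norm_num) (by norm_num : (2 : ℝ) / 3 < 1)).mul_left
      (K * gbar β g₀ j * (2 / 3))
    have hfun : (fun l : ℕ => K * gbar β g₀ j * (2 / 3) ^ (l + 1)) =
        fun l => K * gbar β g₀ j * (2 / 3) * (2 / 3) ^ l := by
      funext l; ring
    have hval : K * gbar β g₀ j * (2 / 3) * (1 - 2 / 3)⁻¹ = 2 * K * gbar β g₀ j := by norm_num; ring
    rw [hfun, ← hval]
    exact h1
  rw [mubar, abs_neg]
  calc |∑' l, invProd β g₀ lam γ j l * sigmaTerm β θ η ξ π g₀ (l + j)|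
      ≤ ∑' l, |invProd β g₀ lam γ j l * sigmaTerm β θ η ξ π g₀ (l + j)| := by
        have := norm_tsum_le_tsum_norm
          (f := fun l => invProd β g₀ lam γ j l * sigmaTerm β θ η ξ π g₀ (l + j))
          (by simpa only [Real.norm_eq_abs] using hs.abs)
        simpa only [Real.norm_eq_abs] using this
    _ ≤ ∑' l : ℕ, K * gbar β g₀ j * (2 / 3) ^ (l + 1) :=
        Summable.tsum_le_tsum (fun l => h.abs_mubar_term_le j l) hs.abs hgeo.summable
    _ = 2 * K * gbar β g₀ j := hgeo.tsum_eq

/-- **`μ̄_j → 0`** (the final condition). [cite: BauerschmidtBrydgesSlade2015Flow, Lemma 2.2 (μ̄_∞ = 0)] -/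
theorem tendsto_mubar_zero : Tendsto (mubar β θ η ξ π g₀ lam γ) atTop (𝓝 0) := by
  refine squeeze_zero_norm (a := fun j => 2 * (A * (1 + g₀ + A / c * g₀)) * gbar β g₀ j)
    (fun j => (Real.norm_eq_abs _).trans_le (h.abs_mubar_le j)) ?_
  simpa using h.tendsto_gbar_zero.const_mul (2 * (A * (1 + g₀ + A / c * g₀)))

/-- **Uniqueness for `μ̄`**: a BOUNDED solution of the `μ̄`-equation is `μ̄` (the `μ`-direction is
expanding: differences grow like `(3/2)^n`).
[cite: BauerschmidtBrydgesSlade2015Flow, Lemma 2.2 (uniqueness of the solution with μ̄_∞ = 0)] -/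
theorem mubar_unique {μ : ℕ → ℝ}
    (hμ : ∀ j, μ (j + 1) = lam * μ j * (1 - γ * (β j * gbar β g₀ j)) +
        η j * gbar β g₀ j - ξ j * gbar β g₀ j ^ 2 - π j * gbar β g₀ j * zbar β θ g₀ j)
    (hbdd : ∃ M, ∀ j, |μ j| ≤ M) : μ = mubar β θ η ξ π g₀ lam γ := by
  obtain ⟨M, hM⟩ := hbdd
  set d : ℕ → ℝ := fun j => μ j - mubar β θ η ξ π g₀ lam γ j with hd
  have hstep : ∀ j, d (j + 1) = lamFac β g₀ lam γ j * d j := fun j => by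
    simp only [hd, hμ j, h.mubar_succ j, lamFac]; ring
  have hgrow : ∀ j n, (3 / 2 : ℝ) ^ n * |d j| ≤ |d (j + n)| := by
    intro j n
    induction n with
    | zero => simp
    | succ n ih =>
      rw [← Nat.add_assoc, hstep, abs_mul,
        abs_of_nonneg (show (0 : ℝ) ≤ lamFac β g₀ lam γ (j + n) by linarith [h.lamFac_ge (j + n)]),
        pow_succ]
      calc (3 / 2 : ℝ) ^ n * (3 / 2) * |d j| = 3 / 2 * ((3 / 2) ^ n * |d j|) := by ring
        _ ≤ lamFac β g₀ lam γ (j + n) * |d (j + n)| :=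
          mul_le_mul (h.lamFac_ge _) ih (by positivity) (by linarith [h.lamFac_ge (j + n)])
  -- |d_{j+n}| is bounded by M + 2K g₀
  have hK := h.K_nonneg
  have hbd : ∀ i, |d i| ≤ M + 2 * (A * (1 + g₀ + A / c * g₀)) * g₀ := fun i => by
    calc |d i| ≤ |μ i| + |mubar β θ η ξ π g₀ lam γ i| := abs_sub _ _
      _ ≤ M + 2 * (A * (1 + g₀ + A / c * g₀)) * gbar β g₀ i := add_le_add (hM i) (h.abs_mubar_le i)
      _ ≤ M + 2 * (A * (1 + g₀ + A / c * g₀)) * g₀ := by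
        have := mul_le_mul_of_nonneg_left (h.gbar_le_init i) (by positivity : 0 ≤ 2 * (A * (1 + g₀ + A / c * g₀)))
        linarith
  funext j
  by_contra hne
  have hdj : 0 < |d j| := abs_pos.2 (sub_ne_zero.2 hne)
  have hpow : Tendsto (fun n : ℕ => (3 / 2 : ℝ) ^ n * |d j|) atTop atTop :=
    (tendsto_pow_atTop_atTop_of_one_lt (by norm_num)).atTop_mul_const hdj
  obtain ⟨n, hn⟩ := (hpow.eventually_gt_atTop (M + 2 * (A * (1 + g₀ + A / c * g₀)) * g₀)).exists
  exact absurd ((hgrow j n).trans (hbd (j + n))) (not_le.2 hn)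

/-! ### The global flow of `φ̄` with its boundary conditions (massless setting) -/

/-- **The global flow of the quadratic flow `φ̄` (massless setting, explicit constants)**:
`V̄_j = (ḡ_j, z̄_j, μ̄_j)` solves `ḡ_{j+1} = ḡ_j - β_jḡ_j²`, `z̄_{j+1} = z̄_j - θ_jḡ_j²`,
`μ̄_{j+1} = L²μ̄_j(1 - γβ_jḡ_j) + η_jḡ_j - ξ_jḡ_j² - π_jḡ_jz̄_j` with `ḡ₀ = g₀` and the final
conditions `(z̄_∞, μ̄_∞) = (0, 0)`, and obeys `ḡ_j ≤ g₀/(1 + g₀cj)`, `|z̄_j| ≤ (A/c)ḡ_j`,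
`|μ̄_j| ≤ 2A(1 + g₀ + (A/c)g₀)ḡ_j`; it is unique (`zbar_unique`, `mubar_unique`). This is the
`m² = 0` (`χ_j ≡ 1`) case of the proposition of §6.1 of the source (= [BBS-rg-flow, Proposition 1.2],
"a special case"), whose general statement carries the weights `χ_j = Ω^{-(j-j_Ω)₊}`.
[cite: BauerschmidtBrydgesSlade2015LogCorr, §6.1 (Proposition: unique global flow of φ̄ with (z̄_∞, μ̄_∞) = (0,0))]
[cite: BauerschmidtBrydgesSlade2015Flow, Proposition 1.2 and Lemma 2.2] -/
theorem quadraticFlow_global :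
    (gbar β g₀ 0 = g₀ ∧
      (∀ j, gbar β g₀ (j + 1) = gbar β g₀ j - β j * gbar β g₀ j ^ 2) ∧
      (∀ j, zbar β θ g₀ (j + 1) = zbar β θ g₀ j - θ j * gbar β g₀ j ^ 2) ∧
      (∀ j, mubar β θ η ξ π g₀ lam γ (j + 1) =
        lam * mubar β θ η ξ π g₀ lam γ j * (1 - γ * (β j * gbar β g₀ j)) +
          η j * gbar β g₀ j - ξ j * gbar β g₀ j ^ 2 - π j * gbar β g₀ j * zbar β θ g₀ j)) ∧
    (Tendsto (zbar β θ g₀) atTop (𝓝 0) ∧ Tendsto (mubar β θ η ξ π g₀ lam γ) atTop (𝓝 0)) ∧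
    (∀ j, gbar β g₀ j ≤ g₀ / (1 + g₀ * c * j) ∧ |zbar β θ g₀ j| ≤ A / c * gbar β g₀ j ∧
      |mubar β θ η ξ π g₀ lam γ j| ≤ 2 * (A * (1 + g₀ + A / c * g₀)) * gbar β g₀ j) :=
  ⟨⟨gbar_zero β g₀, gbar_succ β g₀, h.zbar_succ, h.mubar_succ⟩,
    ⟨tendsto_zbar_zero, h.tendsto_mubar_zero⟩,
    fun j => ⟨h.gbar_le_linear j, h.abs_zbar_le j, h.abs_mubar_le j⟩⟩

end QuadFlowHyp

end CTWSAW

end Literature.Barriers.CriticalPhenomena
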